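import Mathlib
import Summits.Ventures.PercRepro2.Independence
import Summits.Ventures.PercRepro2.Harris
import Summits.Ventures.PercRepro2.HCov
import Summits.Ventures.PercRepro2.CutVertexPaths
import Summits.Ventures.PercRepro2.CutOneFarConn
import Summits.Ventures.PercRepro2.CutTwoFarConn
import Summits.Ventures.PercRepro2.CutTwoFarLaw

/-!
# Two marks behind a cut vertex, IV: THE HARRIS REGION OF THE LAW OF THE PART (blind cell
PercRepro2, typer-1 g50)

The realisability constraints on the law of the part that MINE2-CUTVERTEX.md §13.1 uses («every
negative value of the cubic sits in the Harris-forbidden region … laws that violate Harris on `A`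
are not realisable by any part»).  The five transitive patterns are the events
`L₁ ∩ L₂`, `L₁ ∩ L₂ᶜ`, `L₁ᶜ ∩ L₂`, `L₁ᶜ ∩ L₃`, `L₁ᶜ ∩ L₂ᶜ ∩ L₃ᶜ` in the three INCREASING left
events `L₁ = {w₁ ↔ v}`, `L₂ = {w₂ ↔ v}`, `L₃ = {w₁ ↔ w₂}` (by left edges; `patProb_all` …
`patProb_sep`), the pair marginals are `P(L₁) = q_all + q_x1`, `P(L₂) = q_all + q_x2`,
`P(L₃) = q_all + q_12` (`prob_L₁_eq` …), the law sums to one (`sum_patProb`), and HARRIS–FKG for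
the increasing pairs gives the three constraints of the Harris region

  `(q_all + q_x1)(q_all + q_x2) ≤ q_all`, `(q_all + q_x1)(q_all + q_12) ≤ q_all`,
  `(q_all + q_x2)(q_all + q_12) ≤ q_all`   (**`harris_x1_x2`**, **`harris_x1_12`**, **`harris_x2_12`**)

for every admissible weight vector — in the homogeneous form `q_all (q_r + q_sep) ≥ q_s q_t`
(`harris_x1_x2'` …).  Own work; standard axioms.
-/

namespace Summit.Ventures.PercRepro2

open CovForm CutVertexM9

namespace CutTwoFar

section HarrisRegion

variable {V : Type*} {E : Type*} [Fintype E] [DecidableEq E] {R : Type*} [Field R]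
variable (ends : E → Sym2 V) (side : E → Bool) (v w₁ w₂ : V)

/-- The left connection event `{x ↔ y by left edges}`. -/
def leftConn (x y : V) : Set (Config E) := {ω | Conn ends (CutVertexM9.restrict side true ω) x y}

omit [Fintype E] [DecidableEq E] in
/-- Restriction to a side is monotone in the configuration. -/
lemma restrict_mono {ω ω' : Config E} (h : ω ≤ ω') (b : Bool) :
    CutVertexM9.restrict side b ω ≤ CutVertexM9.restrict side b ω' := by
  intro e
  simp only [CutVertexM9.restrict]
  split_ifs
  · exact h e
  · exact le_rfl

omit [Fintype E] [DecidableEq E] in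
/-- Left connection events are increasing. -/
lemma isUpperSet_leftConn (x y : V) : IsUpperSet (leftConn ends side x y) :=
  fun _ _ h hx => conn_mono (restrict_mono side h true) hx

omit [Fintype E] [DecidableEq E] in
/-- A pattern equation, coordinate by coordinate. -/
lemma pat_eq_iff (ω : Config E) (τ : Fin 3 → Bool) :
    pat ends side v w₁ w₂ ω = τ ↔
      pat ends side v w₁ w₂ ω 0 = τ 0 ∧ pat ends side v w₁ w₂ ω 1 = τ 1 ∧
        pat ends side v w₁ w₂ ω 2 = τ 2 := by
  constructor
  · rintro rfl
    exact ⟨rfl, rfl, rfl⟩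
  · rintro ⟨h0, h1, h2⟩
    funext i
    fin_cases i
    · exact h0
    · exact h1
    · exact h2

omit [Fintype E] [DecidableEq E] in
/-- A gadget edge is closed iff the pair is not joined by left edges. -/
lemma pat_eq_false_iff (ω : Config E) (i : Fin 3) :
    pat ends side v w₁ w₂ ω i = false ↔ ¬ pat ends side v w₁ w₂ ω i = true := by
  cases pat ends side v w₁ w₂ ω i <;> simp

/-! ### The five transitive patterns as events -/

variable {ends side v w₁ w₂}

omit [Fintype E] [DecidableEq E] in
/-- All joined: `L₁ ∩ L₂`. -/
lemma patEvent_all :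
    {ω : Config E | pat ends side v w₁ w₂ ω = ![true, true, true]} =
      leftConn ends side w₁ v ∩ leftConn ends side w₂ v := by
  ext ω
  simp only [Set.mem_setOf_eq, pat_eq_iff, Set.mem_inter_iff, leftConn, Matrix.cons_val_zero,
    Matrix.cons_val_one, Matrix.head_cons, Matrix.cons_val_two, Matrix.tail_cons, pat_zero_iff,
    pat_one_iff, pat_two_iff]
  exact ⟨fun h => ⟨h.1, h.2.1⟩, fun h => ⟨h.1, h.2, conn_trans h.1 (conn_symm h.2)⟩⟩

omit [Fintype E] [DecidableEq E] in
/-- `w₁ ↔ v` only: `L₁ ∩ L₂ᶜ`. -/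
lemma patEvent_x1 :
    {ω : Config E | pat ends side v w₁ w₂ ω = ![true, false, false]} =
      leftConn ends side w₁ v ∩ (leftConn ends side w₂ v)ᶜ := by
  ext ω
  simp only [Set.mem_setOf_eq, pat_eq_iff, Set.mem_inter_iff, Set.mem_compl_iff, leftConn,
    Matrix.cons_val_zero, Matrix.cons_val_one, Matrix.head_cons, Matrix.cons_val_two,
    Matrix.tail_cons, pat_eq_false_iff, pat_zero_iff, pat_one_iff, pat_two_iff]
  exact ⟨fun h => ⟨h.1, h.2.1⟩,
    fun h => ⟨h.1, h.2, fun h12 => h.2 (conn_trans (conn_symm h12) h.1)⟩⟩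

omit [Fintype E] [DecidableEq E] in
/-- `w₂ ↔ v` only: `L₁ᶜ ∩ L₂`. -/
lemma patEvent_x2 :
    {ω : Config E | pat ends side v w₁ w₂ ω = ![false, true, false]} =
      (leftConn ends side w₁ v)ᶜ ∩ leftConn ends side w₂ v := by
  ext ω
  simp only [Set.mem_setOf_eq, pat_eq_iff, Set.mem_inter_iff, Set.mem_compl_iff, leftConn,
    Matrix.cons_val_zero, Matrix.cons_val_one, Matrix.head_cons, Matrix.cons_val_two,
    Matrix.tail_cons, pat_eq_false_iff, pat_zero_iff, pat_one_iff, pat_two_iff]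
  exact ⟨fun h => ⟨h.1, h.2.1⟩,
    fun h => ⟨h.1, h.2, fun h12 => h.1 (conn_trans h12 h.2)⟩⟩

omit [Fintype E] [DecidableEq E] in
/-- `w₁ ↔ w₂` only: `L₁ᶜ ∩ L₃`. -/
lemma patEvent_12 :
    {ω : Config E | pat ends side v w₁ w₂ ω = ![false, false, true]} =
      (leftConn ends side w₁ v)ᶜ ∩ leftConn ends side w₁ w₂ := by
  ext ω
  simp only [Set.mem_setOf_eq, pat_eq_iff, Set.mem_inter_iff, Set.mem_compl_iff, leftConn,
    Matrix.cons_val_zero, Matrix.cons_val_one, Matrix.head_cons, Matrix.cons_val_two,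
    Matrix.tail_cons, pat_eq_false_iff, pat_zero_iff, pat_one_iff, pat_two_iff]
  exact ⟨fun h => ⟨h.1, h.2.2⟩,
    fun h => ⟨h.1, fun h2 => h.1 (conn_trans h.2 h2), h.2⟩⟩

omit [Fintype E] [DecidableEq E] in
/-- All apart: `L₁ᶜ ∩ L₂ᶜ ∩ L₃ᶜ`. -/
lemma patEvent_sep :
    {ω : Config E | pat ends side v w₁ w₂ ω = ![false, false, false]} =
      (leftConn ends side w₁ v)ᶜ ∩ (leftConn ends side w₂ v)ᶜ ∩ (leftConn ends side w₁ w₂)ᶜ := by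
  ext ω
  simp only [Set.mem_setOf_eq, pat_eq_iff, Set.mem_inter_iff, Set.mem_compl_iff, leftConn,
    Matrix.cons_val_zero, Matrix.cons_val_one, Matrix.head_cons, Matrix.cons_val_two,
    Matrix.tail_cons, pat_eq_false_iff, pat_zero_iff, pat_one_iff, pat_two_iff]
  exact ⟨fun h => ⟨⟨h.1, h.2.1⟩, h.2.2⟩, fun h => ⟨h.1.1, h.1.2, h.2⟩⟩

/-! ### The law of the part in the three left events -/

variable (ends side v w₁ w₂) (p : E → R)

/-- `q_all = P(L₁ ∩ L₂)`. -/
lemma patProb_all : patProb ends side v w₁ w₂ p ![true, true, true] =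
    prob p (leftConn ends side w₁ v ∩ leftConn ends side w₂ v) := by
  rw [patProb, patEvent_all]

/-- `q_x1 = P(L₁ ∩ L₂ᶜ)`. -/
lemma patProb_x1 : patProb ends side v w₁ w₂ p ![true, false, false] =
    prob p (leftConn ends side w₁ v ∩ (leftConn ends side w₂ v)ᶜ) := by
  rw [patProb, patEvent_x1]

/-- `q_x2 = P(L₁ᶜ ∩ L₂)`. -/
lemma patProb_x2 : patProb ends side v w₁ w₂ p ![false, true, false] =
    prob p ((leftConn ends side w₁ v)ᶜ ∩ leftConn ends side w₂ v) := by
  rw [patProb, patEvent_x2]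

/-- `q_12 = P(L₁ᶜ ∩ L₃)`. -/
lemma patProb_12 : patProb ends side v w₁ w₂ p ![false, false, true] =
    prob p ((leftConn ends side w₁ v)ᶜ ∩ leftConn ends side w₁ w₂) := by
  rw [patProb, patEvent_12]

/-- `q_sep = P(L₁ᶜ ∩ L₂ᶜ ∩ L₃ᶜ)`. -/
lemma patProb_sep : patProb ends side v w₁ w₂ p ![false, false, false] =
    prob p ((leftConn ends side w₁ v)ᶜ ∩ (leftConn ends side w₂ v)ᶜ ∩
      (leftConn ends side w₁ w₂)ᶜ) := by
  rw [patProb, patEvent_sep]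

/-- The pair marginal `P(L₁) = q_all + q_x1`. -/
lemma prob_L₁_eq : prob p (leftConn ends side w₁ v) =
    patProb ends side v w₁ w₂ p ![true, true, true] +
      patProb ends side v w₁ w₂ p ![true, false, false] := by
  rw [patProb_all, patProb_x1, prob_inter_add_prob_inter_compl]

/-- The pair marginal `P(L₂) = q_all + q_x2`. -/
lemma prob_L₂_eq : prob p (leftConn ends side w₂ v) =
    patProb ends side v w₁ w₂ p ![true, true, true] +
      patProb ends side v w₁ w₂ p ![false, true, false] := by
  rw [patProb_all, patProb_x2, Set.inter_comm, Set.inter_comm _ (leftConn ends side w₂ v),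
    prob_inter_add_prob_inter_compl]

/-- The pair marginal `P(L₃) = q_all + q_12`: `L₁ ∩ L₃ = L₁ ∩ L₂` (transitivity). -/
lemma prob_L₃_eq : prob p (leftConn ends side w₁ w₂) =
    patProb ends side v w₁ w₂ p ![true, true, true] +
      patProb ends side v w₁ w₂ p ![false, false, true] := by
  have h13 : leftConn ends side w₁ v ∩ leftConn ends side w₂ v =
      leftConn ends side w₁ w₂ ∩ leftConn ends side w₁ v := by
    ext ω
    simp only [Set.mem_inter_iff, leftConn, Set.mem_setOf_eq]
    exact ⟨fun h => ⟨conn_trans h.1 (conn_symm h.2), h.1⟩,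
      fun h => ⟨h.2, conn_trans (conn_symm h.1) h.2⟩⟩
  rw [patProb_all, patProb_12, h13, Set.inter_comm _ (leftConn ends side w₁ w₂),
    prob_inter_add_prob_inter_compl]

/-- **The law of the part sums to one.** -/
lemma sum_patProb : ∑ τ, patProb ends side v w₁ w₂ p τ = 1 := by
  have h := prob_Ψ_preimage ends side v w₁ w₂ p Set.univ
  simp only [Set.preimage_univ, prob_univ, mul_one] at h
  exact h.symm

end HarrisRegion

/-! ### The Harris region -/

section HarrisIneq

variable {V : Type*} {E : Type*} [Fintype E] [DecidableEq E] {R : Type*} [Field R] [LinearOrder R]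
  [IsStrictOrderedRing R]
variable (ends : E → Sym2 V) (side : E → Bool) (v w₁ w₂ : V) {p : E → R} (hp : IsProbVec p)
include hp

/-- **Harris on the part, `(w₁ ↔ v)` against `(w₂ ↔ v)`**: `(q_all + q_x1)(q_all + q_x2) ≤ q_all`. -/
theorem harris_x1_x2 :
    (patProb ends side v w₁ w₂ p ![true, true, true] +
        patProb ends side v w₁ w₂ p ![true, false, false]) *
      (patProb ends side v w₁ w₂ p ![true, true, true] +
        patProb ends side v w₁ w₂ p ![false, true, false]) ≤
      patProb ends side v w₁ w₂ p ![true, true, true] := by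
  rw [← prob_L₁_eq, ← prob_L₂_eq, patProb_all]
  exact prob_mul_prob_le_prob_inter hp (isUpperSet_leftConn ends side w₁ v)
    (isUpperSet_leftConn ends side w₂ v)

/-- **Harris on the part, `(w₁ ↔ v)` against `(w₁ ↔ w₂)`**: `(q_all + q_x1)(q_all + q_12) ≤ q_all`. -/
theorem harris_x1_12 :
    (patProb ends side v w₁ w₂ p ![true, true, true] +
        patProb ends side v w₁ w₂ p ![true, false, false]) *
      (patProb ends side v w₁ w₂ p ![true, true, true] +
        patProb ends side v w₁ w₂ p ![false, false, true]) ≤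
      patProb ends side v w₁ w₂ p ![true, true, true] := by
  rw [← prob_L₁_eq, ← prob_L₃_eq, patProb_all]
  refine (prob_mul_prob_le_prob_inter hp (isUpperSet_leftConn ends side w₁ v)
    (isUpperSet_leftConn ends side w₁ w₂)).trans (le_of_eq ?_)
  congr 1
  ext ω
  simp only [Set.mem_inter_iff, leftConn, Set.mem_setOf_eq]
  exact ⟨fun h => ⟨h.1, conn_trans (conn_symm h.2) h.1⟩,
    fun h => ⟨h.1, conn_trans h.1 (conn_symm h.2)⟩⟩

/-- **Harris on the part, `(w₂ ↔ v)` against `(w₁ ↔ w₂)`**: `(q_all + q_x2)(q_all + q_12) ≤ q_all`. -/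
theorem harris_x2_12 :
    (patProb ends side v w₁ w₂ p ![true, true, true] +
        patProb ends side v w₁ w₂ p ![false, true, false]) *
      (patProb ends side v w₁ w₂ p ![true, true, true] +
        patProb ends side v w₁ w₂ p ![false, false, true]) ≤
      patProb ends side v w₁ w₂ p ![true, true, true] := by
  rw [← prob_L₂_eq, ← prob_L₃_eq, patProb_all]
  refine (prob_mul_prob_le_prob_inter hp (isUpperSet_leftConn ends side w₂ v)
    (isUpperSet_leftConn ends side w₁ w₂)).trans (le_of_eq ?_)
  congr 1
  ext ω
  simp only [Set.mem_inter_iff, leftConn, Set.mem_setOf_eq]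
  exact ⟨fun h => ⟨conn_trans h.2 h.1, h.1⟩,
    fun h => ⟨h.2, conn_trans h.1 (conn_symm h.2)⟩⟩

end HarrisIneq

end CutTwoFar

end Summit.Ventures.PercRepro2
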